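import Literature.MathematicalPhysics.QuantumFieldTheory.Balaban1983to89.B13InverseLettersNeumannRadius
import Literature.MathematicalPhysics.QuantumFieldTheory.Balaban1983to89.Node00.OpsYDeltaA
import Literature.MathematicalPhysics.QuantumFieldTheory.Balaban1983to89.B9Eq369Product

/-!
# `Balaban1983to89.B13InverseOperatorCoordinates` — T. Bałaban, *Propagators for lattice gauge theories in a background field*, Commun.
Math. Phys. **99** (1985) 389–434 [Balaban1985BackgroundPropagators], (3.25)–(3.27) p. 395 («G(U) = Δ_a(U)⁻¹», «(Q′G′²Q′*)⁻¹»), Thm 3.4 p. 400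
(«extend to configurations U′U … as analytic functions of A′»), Sect. B (3.60)–(3.65) p. 402 and (3.84)–(3.86) p. 407 («G(U′U) = G(U)(I − V(A)G(U))⁻¹»),
Thm 3.10 (3.107)–(3.108) p. 416; *Renormalization group approach to lattice gauge field theories. II*, Commun. Math. Phys. **116** (1988) 1–22
[Balaban1988RG2Cluster] (2.5)–(2.7) pp. 12–13, p. 15: THE INVERSE READER — NODE 00's `Ring.inverse` PROPAGATORS (`Node00.GpY = G′(U) = Δ′_a(U)⁻¹`,
`Node00.GAY = G(U) = Δ_a(U)⁻¹`, `Node00.XinvY = (Q′G′²Q′*)⁻¹(U)`) READ IN THE ENTRY-LETTER CURRENCY OF THE N10 JUNCTION, ALONG pv27's PENCIL `U = e^{iηA′}U₀`.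

Module 68 (`B13TransportedLiftLetters`, the lane's reader for the LOCAL letters) turns NODE 00's `trLiftY` operators along a complex chart into
coordinate families `u ↦ ((y,k),(x,l)) ↦ φ_k((Φ(u)(δ_x ⊗ e_l))(y))` with `RawEntryLetters`.  For an INVERSE piece the junction's road of record is
module 58's Neumann series (`B13InverseLettersNeumann`; thin radius located in `B13InverseLettersNeumannRadius`), which speaks of the MATRIX
inverse `u ↦ A(u)⁻¹` of a matrix family.  NODE 00's propagators are `Ring.inverse`s of ℂ-linear operators on `X → 𝔸` (`Node00/OpsYDeltaA` §4, (M3):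
«`G′`, `(Q′G′²Q′*)⁻¹`, `G` are `Ring.inverse`s»).  THIS FILE is the dictionary between the two when the coordinates `φ_k`, probes `e_l` come
from a ℂ-BASIS `b` of `𝔸` (at the record `𝔸 = M_N(ℂ)`, any basis): the coordinate family of `Φ` IS `LinearMap.toMatrix` in the product basis
`(x,l) ↦ δ_x ⊗ b_l` (§1), `toMatrix (Ring.inverse Φ) = (toMatrix Φ)⁻¹` (§2), hence 58's located road delivers the letters of
`u ↦ toMatrix (Ring.inverse (Φ u))` from the letters of `u ↦ toMatrix (Φ u)`, ONE right inverse at the centre with (3.108)-decay and a fibre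
bound (§3), and — AT NODE 00's OPERATORS OF RECORD along pv27's pencil `prodCfg U₀ η A′` (`B9Eq39Adjoint.prodCfg`, `B9Eq369Product.prodCfg_zero`) —
the letters of `A′ ↦ toMatrix (G(e^{iηA′}U₀))` from those of `A′ ↦ toMatrix (Δ_a(e^{iηA′}U₀))`, the invertibility of `Δ_a(U₀)` and Theorem 3.10's
decay of `toMatrix (G(U₀))` (§4; the same for `(Q′G′²Q′*)⁻¹`).

statement-level bookkeeping ([folklore] finite-dimensional linear algebra: `Pi.basis`, `LinearMap.toMatrix`, `Ring.inverse` vs `Matrix.inv`)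
over Mathlib, NODE 00's definitions and the landed modules 34 ∕ 58 with citation tags; kernel-checked; THEOREMS ONLY (no `def`); nothing here is
a claim about the Yang–Mills mass gap; NOTHING of Bałaban's is constructed or asserted; NODE 00's `deltaPrimeAY ∕ GpY ∕ deltaAY ∕ GAY ∕ XY ∕ XinvY`,
pv27's `prodCfg` are CONSUMED BY NAME, nothing of `Node00/OpsY*` is modified; no node is discharged; count-neutral.

WHY THIS FILE (cell `pub-ymgap`, HUMAN RULING D-0062 ∕ D-0149, Track A node N10 = [B13]; width seat `pub-ymgap-dag-n10-w2` g2, INTENT-3, on the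
n10-c lane's module-60 lineage «Sect. B's inverse road»; census `N10-RESIDUAL-CENSUS-v16.md`: the A0 chart IS pv27's `prodCfg`; the lane's 68–71
read the LOCAL letters along it; the INVERSE pieces' road is 58 ∕ 58B ∕ 60).  The junction's `hEL` for an inverse factor OF RECORD is a statement
about `toMatrix (GAY …(prodCfg U₀ η A′))`; 58 concludes about `(A A′)⁻¹`; §2–§4 close that gap once, generically, so that the day the lane's
per-letter facts (69–71 + the `Q`-words) are summed into the letters of `A′ ↦ toMatrix (Δ_a(e^{iηA′}U₀))` (module 34 algebra over
`LinearMap.toMatrix_mul ∕ _add`) and N06 supplies Theorem 3.10 for `G(U₀)` at def-Y's operator, the inverse factor's `hEL` is §4 BY NAME at the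
located radius `R₁⋆` (`B13InverseLettersNeumannRadius`).
* §1 `piProdBasis_apply` (`B′(x,l) = δ_x ⊗ b_l`), `piProdBasis_repr`, ★ `toMatrix_piProd_apply` (`toMatrix B′ B′ Φ (y,k) (x,l) = b.repr (Φ(δ_x ⊗ b_l)(y)) k`
  — module 68's coordinate at `φ_k := b.coord k`, `e_l := b_l`), `coordFamily_eq_toMatrix`.
* §2 [folklore] ★ `toMatrix_ringInverse` (`toMatrix v v (Ring.inverse f) = (toMatrix v v f)⁻¹`, any finite basis, both sides total), `toMatrix_mul_eq_one`.
* §3 `rawEntryLetters_toMatrix_of_coordFamily` (68's coordinate letters at `φ_k := b.coord k`, `e_l := b_l` ARE `toMatrix` letters);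
  ★★ `rawEntryLetters_toMatrix_ringInverse_located` — for `Φ : E → Module.End ℂ (X → 𝔸)`: letters `(R, ρ, B)` of `u ↦ toMatrix (Φ u)`, ONE `Ψ₀` with
  `Φ 0 * Ψ₀ = 1` and `‖toMatrix Ψ₀ i j‖ ≤ B_G e^{−ρ d(loc i, loc j)}`, a fibre bound `m`, `0 < R`, `0 ≤ ρ′ < ρ` ⟹ `RawEntryLetters (u ↦ toMatrix (Ring.inverse (Φ u)))
  loc R₁⋆ ρ′ (2B_G)` at the located radius of `B13InverseLettersNeumannRadius`; `…_of_le` (every `R′ ≤ R₁⋆`).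
* §4 AT NODE 00 along pv27's pencil (chart space `A′ : Fin (d+1) → Site → 𝔸`, `prodCfg U₀ η 0 = U₀`), for the THREE `Ring.inverse` letters of print's chain
  `G′ → (Q′G′²Q′*)⁻¹ → G` ([B9] Thms 3.1, 3.2, 3.3 ∕ Sect. B): `GpY_prodCfg_eq_ringInverse` (`rfl`), ★★★ `rawEntryLetters_toMatrix_GpY_prodCfg_located` (site sector;
  `Δ′_a` is LOCAL, so its pencil letters (i) are finite-range letters of the lane's 69 ∕ `B13OpsYPencilTransport` facts) + `_of_le`; `GAY_prodCfg_eq_ringInverse` (`rfl`),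
  ★★★ `rawEntryLetters_toMatrix_GAY_prodCfg_located` — the N10 letters of `A′ ↦ toMatrix (G(e^{iηA′}U₀))` on the located thin ball from (i) the letters of
  `A′ ↦ toMatrix (Δ_a(e^{iηA′}U₀))` [displayed: Thm 3.4 ∕ (3.50) at NODE 00's letters — the lane's 69–71 and their algebra], (ii) `IsUnit (Δ_a(U₀))` and the
  (3.108)-decay of `toMatrix (G(U₀))` [displayed: N06's Thms 3.3 ∕ 3.10 ∕ 3.11 at def-Y's operator], (iii) a fibre bound of the location map;
  `…_of_le`; and the same pair for `(Q′G′²Q′*)⁻¹`: `XinvY_eq_ringInverse`, ★★ `rawEntryLetters_toMatrix_XinvY_prodCfg_located`.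
HONEST FRAMING: a READER.  Which basis `b`, which location map, which `parS ∕ parB ∕ G′` letters and which background `U₀` are «of record» is NODE 00's ∕
def-Y's ∕ def-T's word; the analytic inputs (i)–(ii) stay displayed hypotheses of their owners (N06: GAPS G-B9-05∕06a∕07; the lane: the pencil letters);
N06's real κ-fold coordinate model `B9CoReadingCoords.coordOpK` (n06-d; the (3.42) co-reading currency) is a different object (ℝ-basis, real
matrices) and is not touched; nothing of Bałaban's asserted; N06 ∕ N10 NOT discharged; K1⁷ NOT closed; counts unmoved (typed 28∕28 · discharged 5∕27);
0 `def`, 0 `sorry`, standard axioms; one finite 𝕋⁴ programme at fixed ε — R4 closes the conditional finite-𝕋⁴ rung `BalabanLadder.UV` only; the YM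
mass gap (Clay) is NOT proved by any of this; nothing continuum ∕ ℝ⁴ ∕ OS.

References: T. Bałaban, CMP 99 (1985) 389–434 [Balaban1985BackgroundPropagators] (3.25)–(3.27) p.395, Thm 3.4 and (3.50) p.400, (3.60)–(3.65) p.402,
(3.84)–(3.86) p.407, Thm 3.10 (3.107)–(3.108) pp.415–416; CMP 116 (1988) 1–22 [Balaban1988RG2Cluster] (2.5)–(2.7) pp.12–13, p.15.
────────────────────────────────────────────────────────────────────────────────────────────────────────────────
v1.1 (APPEND-ONLY; §1–§4 byte-identical): + §5 N06's KERNEL-BOUND CURRENCY ⇒ COORDINATE DECAY — `kernelBound_of_unitBall` (unit-ball ⇒ homogeneous),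
`norm_toMatrix_piProd_le`, ★ `toMatrix_decay_of_kernelBound` (a pointwise (3.108)-type bound `‖Φ(δ_x ⊗ E)(y)‖ ≤ B_G‖E‖e^{−ρd(ℓy,ℓx)}` + two basis
numerals `cb, cl` ⟹ the `hG` of §3 ∕ §4), ★★ `rawEntryLetters_toMatrix_ringInverse_located_of_kernelBound` (§3 with input (ii) in that currency).
DOC-ONLY EDITION (dag-n10-w2 g4, 2026-08-28): [B9] page locators corrected per the page owner lit-balaban-r06 — (3.25) p.394; (3.48) p.398; (3.60)–(3.65) p.402,
(3.66)–(3.68) p.403, (3.69)–(3.70) p.404, (3.71)–(3.72) p.405; (3.84)–(3.86) p.407 only; every declaration byte-identical to the previous edition.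
-/

noncomputable section

namespace Literature.MathematicalPhysics.QuantumFieldTheory.Balaban1983to89.B13InverseOperatorCoordinates

open Metric Set Finset Module
open scoped Matrix
open Literature.MathematicalPhysics.QuantumFieldTheory.Balaban1983to89
open Literature.MathematicalPhysics.QuantumFieldTheory.Balaban1983to89.B9Thm37GlueTorus (tdist1)
open Literature.MathematicalPhysics.QuantumFieldTheory.Balaban1983to89.B5TorusCover (UT)
open Literature.MathematicalPhysics.QuantumFieldTheory.Balaban1983to89.B13EntrywiseWalks (RawEntryLetters)
open Literature.MathematicalPhysics.QuantumFieldTheory.Balaban1983to89.B13EntryLetterAlgebra (rawEntryLetters_mono rawEntryLetters_congr)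
open Literature.MathematicalPhysics.QuantumFieldTheory.Balaban1983to89.B13InverseLettersNeumannRadius (rawEntryLetters_inv_of_neumann_torus_located)
open Literature.MathematicalPhysics.QuantumFieldTheory.Balaban1983to89.B9Eq39Adjoint (prodCfg)
open Literature.MathematicalPhysics.QuantumFieldTheory.Balaban1983to89.B9Eq369Product (prodCfg_zero)
open Literature.MathematicalPhysics.QuantumFieldTheory.Balaban1983to89.B6GlobalChartV1 (PV)
open Literature.MathematicalPhysics.QuantumFieldTheory.Balaban1983to89.B6KLevelCensusIndexV1 (KIdx)
open Literature.MathematicalPhysics.QuantumFieldTheory.Balaban1983to89.Node00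

/-! ## §1. Coordinates of a ℂ-linear operator on `X → 𝔸` in the product basis `(x,l) ↦ δ_x ⊗ b_l` -/

section Coord

variable {X κ 𝔸 : Type} [Fintype X] [DecidableEq X] [Fintype κ] [DecidableEq κ] [AddCommGroup 𝔸] [Module ℂ 𝔸]
variable (b : Basis κ ℂ 𝔸)

omit [Fintype κ] [DecidableEq κ] in
/-- The product basis vector at `(x,l)` is the one-site field `δ_x ⊗ b_l`. [folklore]
[cite: Balaban1985BackgroundPropagators, (3.107) p.416 (kernels indexed by lattice points), dictionary] -/
theorem piProdBasis_apply (x : X) (l : κ) :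
    ((Pi.basis fun _ : X => b).reindex (Equiv.sigmaEquivProd X κ)) (x, l) = Pi.single x (b l) := by
  rw [Basis.reindex_apply]
  simp [Equiv.sigmaEquivProd, Pi.basis_apply]

omit [DecidableEq X] [Fintype κ] [DecidableEq κ] in
/-- The product basis' coordinates are `b`'s coordinates site by site. [folklore] [cite: Balaban1985BackgroundPropagators, (3.107) p.416, dictionary] -/
theorem piProdBasis_repr (f : X → 𝔸) (y : X) (k : κ) :
    ((Pi.basis fun _ : X => b).reindex (Equiv.sigmaEquivProd X κ)).repr f (y, k) = b.repr (f y) k := by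
  rw [Basis.repr_reindex_apply]
  simp [Equiv.sigmaEquivProd, Pi.basis_repr]

/-- ★ **THE MATRIX OF `Φ` IN THE PRODUCT BASIS IS MODULE 68's COORDINATE FAMILY** at `φ_k := b.coord k`, `e_l := b_l`:
`toMatrix B′ B′ Φ (y,k) (x,l) = b.repr (Φ(δ_x ⊗ b_l)(y)) k`. [folklore] [cite: Balaban1985BackgroundPropagators, (3.107)–(3.108) p.416, dictionary] -/
theorem toMatrix_piProd_apply (Φ : Module.End ℂ (X → 𝔸)) (i j : X × κ) :
    LinearMap.toMatrix ((Pi.basis fun _ : X => b).reindex (Equiv.sigmaEquivProd X κ))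
      ((Pi.basis fun _ : X => b).reindex (Equiv.sigmaEquivProd X κ)) Φ i j = b.repr (Φ (Pi.single j.1 (b j.2)) i.1) i.2 := by
  obtain ⟨y, k⟩ := i
  obtain ⟨x, l⟩ := j
  rw [LinearMap.toMatrix_apply, piProdBasis_apply, piProdBasis_repr]

/-- The coordinate family `u ↦ ((y,k),(x,l)) ↦ b.coord k (Φ(u)(δ_x ⊗ b_l)(y))` IS `u ↦ toMatrix B′ B′ (Φ u)`. [folklore]
[cite: Balaban1985BackgroundPropagators, (3.107)–(3.108) p.416, dictionary] -/
theorem coordFamily_eq_toMatrix {E : Type*} (Φ : E → Module.End ℂ (X → 𝔸)) :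
    (fun u (i j : X × κ) => b.coord i.2 (Φ u (Pi.single j.1 (b j.2)) i.1)) =
      fun u => LinearMap.toMatrix ((Pi.basis fun _ : X => b).reindex (Equiv.sigmaEquivProd X κ))
        ((Pi.basis fun _ : X => b).reindex (Equiv.sigmaEquivProd X κ)) (Φ u) := by
  funext u i j
  rw [toMatrix_piProd_apply, Basis.coord_apply]

end Coord

/-! ## §2. [folklore] `Ring.inverse` of an operator ↔ `Matrix.inv` of its matrix -/

section Inverse

variable {n M : Type} [Fintype n] [DecidableEq n] [AddCommGroup M] [Module ℂ M] (v : Basis n ℂ M)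

/-- ★ **`toMatrix (Ring.inverse f) = (toMatrix f)⁻¹`** — both sides TOTAL: the genuine inverse where `f` is a unit, `0` elsewhere (Mathlib's
`Matrix.inv` of a singular matrix is `0`, `Ring.inverse` of a non-unit is `0`). [folklore]
[cite: Balaban1985BackgroundPropagators, (3.27) p.395 («G(U) = Δ_a(U)⁻¹»), dictionary] -/
theorem toMatrix_ringInverse (f : Module.End ℂ M) :
    LinearMap.toMatrix v v (Ring.inverse f) = (LinearMap.toMatrix v v f)⁻¹ := by
  by_cases hf : IsUnit f
  · obtain ⟨u, rfl⟩ := hf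
    rw [Ring.inverse_unit]
    symm
    apply Matrix.inv_eq_left_inv
    rw [← LinearMap.toMatrix_mul, Units.inv_mul, LinearMap.toMatrix_one]
  · rw [Ring.inverse_non_unit _ hf, map_zero]
    have h : ¬IsUnit (LinearMap.toMatrix v v f).det := fun h =>
      hf ((LinearMap.isUnit_toMatrix_iff v).1 ((Matrix.isUnit_iff_isUnit_det _).2 h))
    rw [Matrix.nonsing_inv_apply_not_isUnit _ h]

/-- A right inverse in `Module.End` is a right inverse of matrices. [folklore] [cite: Balaban1985BackgroundPropagators, (3.27) p.395, dictionary] -/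
theorem toMatrix_mul_eq_one {f g : Module.End ℂ M} (h : f * g = 1) :
    LinearMap.toMatrix v v f * LinearMap.toMatrix v v g = 1 := by
  rw [← LinearMap.toMatrix_mul, h, LinearMap.toMatrix_one]

end Inverse

/-! ## §3. ★★ The inverse reader: letters of `u ↦ toMatrix (Ring.inverse (Φ u))` by module 58's located Neumann road -/

section Reader

variable {ν : ℕ} {Nf : Fin ν → ℕ} [∀ i, NeZero (Nf i)]
variable {E : Type*} [NormedAddCommGroup E] [NormedSpace ℂ E]
variable {X κ 𝔸 : Type} [Fintype X] [DecidableEq X] [Fintype κ] [DecidableEq κ] [AddCommGroup 𝔸] [Module ℂ 𝔸]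
variable (b : Basis κ ℂ 𝔸)

/-- **MODULE 68's COORDINATE LETTERS ARE `toMatrix` LETTERS**: a `RawEntryLetters` datum for the coordinate family
`u ↦ ((y,k),(x,l)) ↦ b.coord k (Φ(u)(δ_x ⊗ b_l)(y))` (the shape 68 ∕ 69 deliver at `φ_k := b.coord k`, `e_l := b_l`) IS one for
`u ↦ toMatrix B′ B′ (Φ u)` (§1 `coordFamily_eq_toMatrix`). [cite: Balaban1985BackgroundPropagators, (3.107)–(3.108) p.416, dictionary] -/
theorem rawEntryLetters_toMatrix_of_coordFamily (Φ : E → Module.End ℂ (X → 𝔸)) {loc : X × κ → UT Nf} {R ρ B : ℝ}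
    (h : RawEntryLetters (fun u (i j : X × κ) => b.coord i.2 (Φ u (Pi.single j.1 (b j.2)) i.1)) loc R ρ B) :
    RawEntryLetters (fun u => LinearMap.toMatrix ((Pi.basis fun _ : X => b).reindex (Equiv.sigmaEquivProd X κ))
      ((Pi.basis fun _ : X => b).reindex (Equiv.sigmaEquivProd X κ)) (Φ u)) loc R ρ B := by
  rw [← coordFamily_eq_toMatrix]
  exact h

/-- ★★ **THE INVERSE READER, THIN RADIUS LOCATED.**  A family `Φ : E → Module.End ℂ (X → 𝔸)` whose matrices `u ↦ toMatrix B′ B′ (Φ u)` in the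
product basis have letters `(R, ρ, B)` on the chart ball (the complexified operator — its owner's); ONE right inverse `Ψ₀` of `Φ 0` whose matrix has
(3.108)-decay `B_G` at rate `ρ` (Theorem 3.10 at the centre — its owner's); a fibre bound `m` of the location map; `0 < R`; a target rate
`0 ≤ ρ′ < ρ` ⟹ the matrices of `u ↦ Ring.inverse (Φ u)` have letters `(R₁⋆, ρ′, 2B_G)` at the located radius
`R₁⋆ = R ∕ (4·B·B_G·(m·c₀(1,(ρ−ρ′)∕3)^ν)² + 1)` (58 §3 ∕ `B13InverseLettersNeumannRadius` + §2).
[cite: Balaban1985BackgroundPropagators, (3.27) p.395, (3.60)–(3.65) p.402, (3.84)–(3.86) p.407, Thm 3.10 (3.107)–(3.108) p.416; Balaban1988RG2Cluster, p.13, p.15] -/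
theorem rawEntryLetters_toMatrix_ringInverse_located (Φ : E → Module.End ℂ (X → 𝔸)) {Ψ₀ : Module.End ℂ (X → 𝔸)}
    {loc : X × κ → UT Nf} {R ρ B BG : ℝ} {m : ℕ}
    (hA : RawEntryLetters (fun u => LinearMap.toMatrix ((Pi.basis fun _ : X => b).reindex (Equiv.sigmaEquivProd X κ))
      ((Pi.basis fun _ : X => b).reindex (Equiv.sigmaEquivProd X κ)) (Φ u)) loc R ρ B)
    (h0 : Φ 0 * Ψ₀ = 1)
    (hG : ∀ i j, ‖LinearMap.toMatrix ((Pi.basis fun _ : X => b).reindex (Equiv.sigmaEquivProd X κ))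
      ((Pi.basis fun _ : X => b).reindex (Equiv.sigmaEquivProd X κ)) Ψ₀ i j‖ ≤ BG * Real.exp (-(ρ * tdist1 Nf (loc i) (loc j))))
    (hBG : 0 ≤ BG) (hfib : ∀ y : UT Nf, (univ.filter fun k => loc k = y).card ≤ m) (hR : 0 < R)
    {ρ' : ℝ} (hρ'0 : 0 ≤ ρ') (hρ' : ρ' < ρ) :
    RawEntryLetters (fun u => LinearMap.toMatrix ((Pi.basis fun _ : X => b).reindex (Equiv.sigmaEquivProd X κ))
        ((Pi.basis fun _ : X => b).reindex (Equiv.sigmaEquivProd X κ)) (Ring.inverse (Φ u))) loc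
      (R / (4 * (B * BG * (m * B6.c0 1 ((ρ - ρ') / 3) ^ ν) * (m * B6.c0 1 ((ρ - ρ') / 3) ^ ν)) + 1)) ρ' (2 * BG) := by
  have h := rawEntryLetters_inv_of_neumann_torus_located hA (toMatrix_mul_eq_one _ h0) hG hBG hfib hR hρ'0 hρ'
  exact rawEntryLetters_congr h fun u _ => toMatrix_ringInverse _ (Φ u)

/-- **… at every smaller radius** `R′ ≤ R₁⋆` (the junction's located inequality `rf.R ≤ R₁⋆`).
[cite: Balaban1985BackgroundPropagators, (3.27) p.395, (3.62)–(3.64) p.402, Thm 3.10 (3.108) p.416] -/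
theorem rawEntryLetters_toMatrix_ringInverse_located_of_le (Φ : E → Module.End ℂ (X → 𝔸)) {Ψ₀ : Module.End ℂ (X → 𝔸)}
    {loc : X × κ → UT Nf} {R ρ B BG : ℝ} {m : ℕ}
    (hA : RawEntryLetters (fun u => LinearMap.toMatrix ((Pi.basis fun _ : X => b).reindex (Equiv.sigmaEquivProd X κ))
      ((Pi.basis fun _ : X => b).reindex (Equiv.sigmaEquivProd X κ)) (Φ u)) loc R ρ B)
    (h0 : Φ 0 * Ψ₀ = 1)
    (hG : ∀ i j, ‖LinearMap.toMatrix ((Pi.basis fun _ : X => b).reindex (Equiv.sigmaEquivProd X κ))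
      ((Pi.basis fun _ : X => b).reindex (Equiv.sigmaEquivProd X κ)) Ψ₀ i j‖ ≤ BG * Real.exp (-(ρ * tdist1 Nf (loc i) (loc j))))
    (hBG : 0 ≤ BG) (hfib : ∀ y : UT Nf, (univ.filter fun k => loc k = y).card ≤ m) (hR : 0 < R)
    {ρ' : ℝ} (hρ'0 : 0 ≤ ρ') (hρ' : ρ' < ρ) {R' : ℝ}
    (hR' : R' ≤ R / (4 * (B * BG * (m * B6.c0 1 ((ρ - ρ') / 3) ^ ν) * (m * B6.c0 1 ((ρ - ρ') / 3) ^ ν)) + 1)) :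
    RawEntryLetters (fun u => LinearMap.toMatrix ((Pi.basis fun _ : X => b).reindex (Equiv.sigmaEquivProd X κ))
        ((Pi.basis fun _ : X => b).reindex (Equiv.sigmaEquivProd X κ)) (Ring.inverse (Φ u))) loc R' ρ' (2 * BG) :=
  rawEntryLetters_mono (rawEntryLetters_toMatrix_ringInverse_located b Φ hA h0 hG hBG hfib hR hρ'0 hρ') hR' le_rfl le_rfl

end Reader

/-! ## §4. At NODE 00's propagators of record along pv27's pencil `U = e^{iηA′}U₀` -/

section NodeOO

variable {d ℓ : ℕ} {hd : 1 ≤ d + 1} {hL : Odd (ℓ + 1) ∧ 1 < ℓ + 1} {b₀ b₁ : ℝ}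
variable {𝔸 : Type} [NormedRing 𝔸] [NormedAlgebra ℂ 𝔸] [CompleteSpace 𝔸]
variable (i : KIdx d ℓ hd hL b₀ b₁) {κ : Type} [Fintype κ] [DecidableEq κ] (b : Basis κ ℂ 𝔸)
variable {ν : ℕ} {Nf : Fin ν → ℕ} [∀ i, NeZero (Nf i)]

/-- NODE 00's `G′(U) = (Δ′_a(U))⁻¹` along the pencil IS the `Ring.inverse` of `Δ′_a` along the pencil (`rfl`).
[cite: Balaban1985BackgroundPropagators, (3.24)–(3.25) pp.394–395 («Its inverse is denoted by G′, or G′(U)»)] -/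
theorem GpY_prodCfg_eq_ringInverse (par : SiteParY 𝔸 i) (U₀ : CfgY 𝔸 i) (η : ℝ)
    (a : Fin (d + 1) → Site (PV d ℓ i.m i.K hd hL) 0 → 𝔸) :
    GpY i par (prodCfg U₀ η a) = Ring.inverse (deltaPrimeAY i par (prodCfg U₀ η a)) := rfl

/-- ★★★ **THE N10 LETTERS OF NODE 00's `G′(e^{iηA′}U₀) = (Δ′_a(e^{iηA′}U₀))⁻¹` ALONG pv27's PENCIL, THIN RADIUS LOCATED** — the FIRST inverse of print's
chain (Thm 3.1 ∕ Sect. B (3.60)–(3.65): `Δ′_a(U) = Δ_U + Σ_j a_j(L^jη)^{−2}Q′_j(U)*Q′_j(U)` is a LOCAL operator, so its pencil letters (i) are finite-range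
letters of NODE 00's `lapSL ∕ avgTrY` along the pencil — the lane's 69 ∕ `B13OpsYPencilTransport` facts, displayed here).  Inputs: (i) the letters `(R, ρ, B)` of
`A′ ↦ toMatrix B′ B′ (Δ′_a(e^{iηA′}U₀))` on the site sector `SiteY i × κ`; (ii) `IsUnit (Δ′_a(U₀))` and the (3.108)-type decay `B_G` at rate `ρ` of
`toMatrix B′ B′ (G′(U₀))` (N06's Thm 3.1 ∕ 3.10 at def-Y's operator); (iii) a fibre bound `m`; `0 < R`; `0 ≤ ρ′ < ρ`.  Conclusion:
`RawEntryLetters (A′ ↦ toMatrix B′ B′ (G′(e^{iηA′}U₀))) loc R₁⋆ ρ′ (2B_G)`.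
[cite: Balaban1985BackgroundPropagators, (3.24)–(3.25) pp.394–395, Thm 3.1 (3.42) p.397, Thm 3.4 and (3.50) p.400, (3.60)–(3.65) p.402, Thm 3.10 (3.108) p.416;
Balaban1988RG2Cluster, (2.5)–(2.7) pp.12–13, p.15] -/
theorem rawEntryLetters_toMatrix_GpY_prodCfg_located (par : SiteParY 𝔸 i) (U₀ : CfgY 𝔸 i) (η : ℝ)
    {loc : SiteY i × κ → UT Nf} {R ρ B BG : ℝ} {m : ℕ}
    (hA : RawEntryLetters (fun a : Fin (d + 1) → Site (PV d ℓ i.m i.K hd hL) 0 → 𝔸 =>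
      LinearMap.toMatrix ((Pi.basis fun _ : SiteY i => b).reindex (Equiv.sigmaEquivProd (SiteY i) κ))
        ((Pi.basis fun _ : SiteY i => b).reindex (Equiv.sigmaEquivProd (SiteY i) κ)) (deltaPrimeAY i par (prodCfg U₀ η a))) loc R ρ B)
    (hU : IsUnit (deltaPrimeAY i par U₀))
    (hG : ∀ p q, ‖LinearMap.toMatrix ((Pi.basis fun _ : SiteY i => b).reindex (Equiv.sigmaEquivProd (SiteY i) κ))
      ((Pi.basis fun _ : SiteY i => b).reindex (Equiv.sigmaEquivProd (SiteY i) κ)) (GpY i par U₀) p q‖ ≤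
        BG * Real.exp (-(ρ * tdist1 Nf (loc p) (loc q))))
    (hBG : 0 ≤ BG) (hfib : ∀ y : UT Nf, (univ.filter fun k => loc k = y).card ≤ m) (hR : 0 < R)
    {ρ' : ℝ} (hρ'0 : 0 ≤ ρ') (hρ' : ρ' < ρ) :
    RawEntryLetters (fun a : Fin (d + 1) → Site (PV d ℓ i.m i.K hd hL) 0 → 𝔸 =>
      LinearMap.toMatrix ((Pi.basis fun _ : SiteY i => b).reindex (Equiv.sigmaEquivProd (SiteY i) κ))
        ((Pi.basis fun _ : SiteY i => b).reindex (Equiv.sigmaEquivProd (SiteY i) κ)) (GpY i par (prodCfg U₀ η a))) loc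
      (R / (4 * (B * BG * (m * B6.c0 1 ((ρ - ρ') / 3) ^ ν) * (m * B6.c0 1 ((ρ - ρ') / 3) ^ ν)) + 1)) ρ' (2 * BG) := by
  have h0 : deltaPrimeAY i par (prodCfg U₀ η 0) * GpY i par U₀ = 1 := by
    rw [prodCfg_zero]
    exact deltaPrimeAY_mul_GpY i par U₀ hU
  exact rawEntryLetters_toMatrix_ringInverse_located b (fun a => deltaPrimeAY i par (prodCfg U₀ η a)) hA h0 hG hBG hfib hR hρ'0 hρ'

/-- **… at every smaller radius** `R′ ≤ R₁⋆`. [cite: Balaban1985BackgroundPropagators, (3.25) p.394, (3.62)–(3.64) p.402, Thm 3.10 (3.108) p.416] -/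
theorem rawEntryLetters_toMatrix_GpY_prodCfg_located_of_le (par : SiteParY 𝔸 i) (U₀ : CfgY 𝔸 i) (η : ℝ)
    {loc : SiteY i × κ → UT Nf} {R ρ B BG : ℝ} {m : ℕ}
    (hA : RawEntryLetters (fun a : Fin (d + 1) → Site (PV d ℓ i.m i.K hd hL) 0 → 𝔸 =>
      LinearMap.toMatrix ((Pi.basis fun _ : SiteY i => b).reindex (Equiv.sigmaEquivProd (SiteY i) κ))
        ((Pi.basis fun _ : SiteY i => b).reindex (Equiv.sigmaEquivProd (SiteY i) κ)) (deltaPrimeAY i par (prodCfg U₀ η a))) loc R ρ B)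
    (hU : IsUnit (deltaPrimeAY i par U₀))
    (hG : ∀ p q, ‖LinearMap.toMatrix ((Pi.basis fun _ : SiteY i => b).reindex (Equiv.sigmaEquivProd (SiteY i) κ))
      ((Pi.basis fun _ : SiteY i => b).reindex (Equiv.sigmaEquivProd (SiteY i) κ)) (GpY i par U₀) p q‖ ≤
        BG * Real.exp (-(ρ * tdist1 Nf (loc p) (loc q))))
    (hBG : 0 ≤ BG) (hfib : ∀ y : UT Nf, (univ.filter fun k => loc k = y).card ≤ m) (hR : 0 < R)
    {ρ' : ℝ} (hρ'0 : 0 ≤ ρ') (hρ' : ρ' < ρ) {R' : ℝ}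
    (hR' : R' ≤ R / (4 * (B * BG * (m * B6.c0 1 ((ρ - ρ') / 3) ^ ν) * (m * B6.c0 1 ((ρ - ρ') / 3) ^ ν)) + 1)) :
    RawEntryLetters (fun a : Fin (d + 1) → Site (PV d ℓ i.m i.K hd hL) 0 → 𝔸 =>
      LinearMap.toMatrix ((Pi.basis fun _ : SiteY i => b).reindex (Equiv.sigmaEquivProd (SiteY i) κ))
        ((Pi.basis fun _ : SiteY i => b).reindex (Equiv.sigmaEquivProd (SiteY i) κ)) (GpY i par (prodCfg U₀ η a))) loc
      R' ρ' (2 * BG) :=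
  rawEntryLetters_mono (rawEntryLetters_toMatrix_GpY_prodCfg_located i b par U₀ η hA hU hG hBG hfib hR hρ'0 hρ') hR' le_rfl le_rfl

/-- NODE 00's propagator along the pencil IS the `Ring.inverse` of `Δ_a` along the pencil (`rfl`).
[cite: Balaban1985BackgroundPropagators, (3.27) p.395 («G(U) = Δ_a(U)⁻¹»)] -/
theorem GAY_prodCfg_eq_ringInverse (parS : SiteParY 𝔸 i) (parB : BondParY 𝔸 i) (Gp : SiteOpY 𝔸 i) (U₀ : CfgY 𝔸 i) (η : ℝ)
    (a : Fin (d + 1) → Site (PV d ℓ i.m i.K hd hL) 0 → 𝔸) :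
    GAY i parS parB Gp (prodCfg U₀ η a) = Ring.inverse (deltaAY i parS parB Gp (prodCfg U₀ η a)) := rfl

/-- ★★★ **THE N10 LETTERS OF NODE 00's PROPAGATOR `G(e^{iηA′}U₀) = Δ_a(e^{iηA′}U₀)⁻¹` ALONG pv27's PENCIL, THIN RADIUS LOCATED.**  Inputs (all displayed,
owned elsewhere): (i) the letters `(R, ρ, B)` of `A′ ↦ toMatrix B′ B′ (Δ_a(e^{iηA′}U₀))` on the chart ball `‖A′‖ < R` (Thm 3.4 ∕ (3.50) at NODE 00's
letters — the lane's pencil facts summed by module 34); (ii) `IsUnit (Δ_a(U₀))` and the (3.108)-decay `B_G` at rate `ρ` of `toMatrix B′ B′ (G(U₀))` (N06's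
Thms 3.3 ∕ 3.10 ∕ 3.11 at def-Y's operator); (iii) a fibre bound `m` of the location map; `0 < R`; a target rate `0 ≤ ρ′ < ρ`.  Conclusion:
`RawEntryLetters (A′ ↦ toMatrix B′ B′ (G(e^{iηA′}U₀))) loc R₁⋆ ρ′ (2B_G)` at the located radius — Sect. B's (3.86) at NODE 00's objects.
[cite: Balaban1985BackgroundPropagators, (3.26)–(3.27) p.395, Thm 3.4 and (3.50) p.400, (3.84)–(3.86) p.407, Thm 3.10 (3.107)–(3.108) p.416;
Balaban1988RG2Cluster, (2.5)–(2.7) pp.12–13, p.15] -/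
theorem rawEntryLetters_toMatrix_GAY_prodCfg_located (parS : SiteParY 𝔸 i) (parB : BondParY 𝔸 i) (Gp : SiteOpY 𝔸 i)
    (U₀ : CfgY 𝔸 i) (η : ℝ) {loc : FBondY i × κ → UT Nf} {R ρ B BG : ℝ} {m : ℕ}
    (hA : RawEntryLetters (fun a : Fin (d + 1) → Site (PV d ℓ i.m i.K hd hL) 0 → 𝔸 =>
      LinearMap.toMatrix ((Pi.basis fun _ : FBondY i => b).reindex (Equiv.sigmaEquivProd (FBondY i) κ))
        ((Pi.basis fun _ : FBondY i => b).reindex (Equiv.sigmaEquivProd (FBondY i) κ)) (deltaAY i parS parB Gp (prodCfg U₀ η a))) loc R ρ B)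
    (hU : IsUnit (deltaAY i parS parB Gp U₀))
    (hG : ∀ p q, ‖LinearMap.toMatrix ((Pi.basis fun _ : FBondY i => b).reindex (Equiv.sigmaEquivProd (FBondY i) κ))
      ((Pi.basis fun _ : FBondY i => b).reindex (Equiv.sigmaEquivProd (FBondY i) κ)) (GAY i parS parB Gp U₀) p q‖ ≤
        BG * Real.exp (-(ρ * tdist1 Nf (loc p) (loc q))))
    (hBG : 0 ≤ BG) (hfib : ∀ y : UT Nf, (univ.filter fun k => loc k = y).card ≤ m) (hR : 0 < R)
    {ρ' : ℝ} (hρ'0 : 0 ≤ ρ') (hρ' : ρ' < ρ) :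
    RawEntryLetters (fun a : Fin (d + 1) → Site (PV d ℓ i.m i.K hd hL) 0 → 𝔸 =>
      LinearMap.toMatrix ((Pi.basis fun _ : FBondY i => b).reindex (Equiv.sigmaEquivProd (FBondY i) κ))
        ((Pi.basis fun _ : FBondY i => b).reindex (Equiv.sigmaEquivProd (FBondY i) κ)) (GAY i parS parB Gp (prodCfg U₀ η a))) loc
      (R / (4 * (B * BG * (m * B6.c0 1 ((ρ - ρ') / 3) ^ ν) * (m * B6.c0 1 ((ρ - ρ') / 3) ^ ν)) + 1)) ρ' (2 * BG) := by
  have h0 : deltaAY i parS parB Gp (prodCfg U₀ η 0) * GAY i parS parB Gp U₀ = 1 := by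
    rw [prodCfg_zero]
    exact deltaAY_mul_GAY i hU
  exact rawEntryLetters_toMatrix_ringInverse_located b (fun a => deltaAY i parS parB Gp (prodCfg U₀ η a)) hA h0 hG hBG hfib hR hρ'0 hρ'

/-- **… at every smaller radius** `R′ ≤ R₁⋆` (the junction reads the inverse factor at the rung's chart radius `rf.R`).
[cite: Balaban1985BackgroundPropagators, (3.27) p.395, (3.86) p.407, Thm 3.10 (3.108) p.416] -/
theorem rawEntryLetters_toMatrix_GAY_prodCfg_located_of_le (parS : SiteParY 𝔸 i) (parB : BondParY 𝔸 i) (Gp : SiteOpY 𝔸 i)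
    (U₀ : CfgY 𝔸 i) (η : ℝ) {loc : FBondY i × κ → UT Nf} {R ρ B BG : ℝ} {m : ℕ}
    (hA : RawEntryLetters (fun a : Fin (d + 1) → Site (PV d ℓ i.m i.K hd hL) 0 → 𝔸 =>
      LinearMap.toMatrix ((Pi.basis fun _ : FBondY i => b).reindex (Equiv.sigmaEquivProd (FBondY i) κ))
        ((Pi.basis fun _ : FBondY i => b).reindex (Equiv.sigmaEquivProd (FBondY i) κ)) (deltaAY i parS parB Gp (prodCfg U₀ η a))) loc R ρ B)
    (hU : IsUnit (deltaAY i parS parB Gp U₀))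
    (hG : ∀ p q, ‖LinearMap.toMatrix ((Pi.basis fun _ : FBondY i => b).reindex (Equiv.sigmaEquivProd (FBondY i) κ))
      ((Pi.basis fun _ : FBondY i => b).reindex (Equiv.sigmaEquivProd (FBondY i) κ)) (GAY i parS parB Gp U₀) p q‖ ≤
        BG * Real.exp (-(ρ * tdist1 Nf (loc p) (loc q))))
    (hBG : 0 ≤ BG) (hfib : ∀ y : UT Nf, (univ.filter fun k => loc k = y).card ≤ m) (hR : 0 < R)
    {ρ' : ℝ} (hρ'0 : 0 ≤ ρ') (hρ' : ρ' < ρ) {R' : ℝ}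
    (hR' : R' ≤ R / (4 * (B * BG * (m * B6.c0 1 ((ρ - ρ') / 3) ^ ν) * (m * B6.c0 1 ((ρ - ρ') / 3) ^ ν)) + 1)) :
    RawEntryLetters (fun a : Fin (d + 1) → Site (PV d ℓ i.m i.K hd hL) 0 → 𝔸 =>
      LinearMap.toMatrix ((Pi.basis fun _ : FBondY i => b).reindex (Equiv.sigmaEquivProd (FBondY i) κ))
        ((Pi.basis fun _ : FBondY i => b).reindex (Equiv.sigmaEquivProd (FBondY i) κ)) (GAY i parS parB Gp (prodCfg U₀ η a))) loc
      R' ρ' (2 * BG) :=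
  rawEntryLetters_mono (rawEntryLetters_toMatrix_GAY_prodCfg_located i b parS parB Gp U₀ η hA hU hG hBG hfib hR hρ'0 hρ') hR' le_rfl le_rfl

/-- NODE 00's `(Q′G′²Q′*)⁻¹(U)` IS the `Ring.inverse` of `XY` (`rfl`), and a right inverse where `XY U` is a unit.
[cite: Balaban1985BackgroundPropagators, (3.25) p.394, Thm 3.2 p.398] -/
theorem XY_mul_XinvY {parS : SiteParY 𝔸 i} {Gp : SiteOpY 𝔸 i} {U : CfgY 𝔸 i} (hU : IsUnit (XY i parS Gp U)) :
    XY i parS Gp U * XinvY i parS Gp U = 1 :=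
  Ring.mul_inverse_cancel _ hU

/-- ★★ **THE N10 LETTERS OF NODE 00's `(Q′G′²Q′*)⁻¹(e^{iηA′}U₀)` ALONG THE PENCIL, THIN RADIUS LOCATED** — the same reading for the block-sector inverse
letter `Node00.XinvY` (behind `CY`, `RY`, hence inside `Δ_a`): letters of `A′ ↦ toMatrix (XY(e^{iηA′}U₀))` on the chart ball, `IsUnit (XY(U₀))`, the
decay of `toMatrix (XinvY(U₀))` (N06's Thm 3.2 ∕ (3.48) at def-Y's operator), a fibre bound, `0 < R`, `0 ≤ ρ′ < ρ` ⟹ letters `(R₁⋆, ρ′, 2B_G)`.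
[cite: Balaban1985BackgroundPropagators, (3.25) p.394, Thm 3.2 p.398, (3.48) p.398, Thm 3.4 p.400, (3.86) p.407, Thm 3.10 (3.108) p.416] -/
theorem rawEntryLetters_toMatrix_XinvY_prodCfg_located (parS : SiteParY 𝔸 i) (Gp : SiteOpY 𝔸 i)
    (U₀ : CfgY 𝔸 i) (η : ℝ) {loc : BlkY i × κ → UT Nf} {R ρ B BG : ℝ} {m : ℕ}
    (hA : RawEntryLetters (fun a : Fin (d + 1) → Site (PV d ℓ i.m i.K hd hL) 0 → 𝔸 =>
      LinearMap.toMatrix ((Pi.basis fun _ : BlkY i => b).reindex (Equiv.sigmaEquivProd (BlkY i) κ))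
        ((Pi.basis fun _ : BlkY i => b).reindex (Equiv.sigmaEquivProd (BlkY i) κ)) (XY i parS Gp (prodCfg U₀ η a))) loc R ρ B)
    (hU : IsUnit (XY i parS Gp U₀))
    (hG : ∀ p q, ‖LinearMap.toMatrix ((Pi.basis fun _ : BlkY i => b).reindex (Equiv.sigmaEquivProd (BlkY i) κ))
      ((Pi.basis fun _ : BlkY i => b).reindex (Equiv.sigmaEquivProd (BlkY i) κ)) (XinvY i parS Gp U₀) p q‖ ≤
        BG * Real.exp (-(ρ * tdist1 Nf (loc p) (loc q))))
    (hBG : 0 ≤ BG) (hfib : ∀ y : UT Nf, (univ.filter fun k => loc k = y).card ≤ m) (hR : 0 < R)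
    {ρ' : ℝ} (hρ'0 : 0 ≤ ρ') (hρ' : ρ' < ρ) :
    RawEntryLetters (fun a : Fin (d + 1) → Site (PV d ℓ i.m i.K hd hL) 0 → 𝔸 =>
      LinearMap.toMatrix ((Pi.basis fun _ : BlkY i => b).reindex (Equiv.sigmaEquivProd (BlkY i) κ))
        ((Pi.basis fun _ : BlkY i => b).reindex (Equiv.sigmaEquivProd (BlkY i) κ)) (XinvY i parS Gp (prodCfg U₀ η a))) loc
      (R / (4 * (B * BG * (m * B6.c0 1 ((ρ - ρ') / 3) ^ ν) * (m * B6.c0 1 ((ρ - ρ') / 3) ^ ν)) + 1)) ρ' (2 * BG) := by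
  have h0 : XY i parS Gp (prodCfg U₀ η 0) * XinvY i parS Gp U₀ = 1 := by
    rw [prodCfg_zero]
    exact XY_mul_XinvY i hU
  exact rawEntryLetters_toMatrix_ringInverse_located b (fun a => XY i parS Gp (prodCfg U₀ η a)) hA h0 hG hBG hfib hR hρ'0 hρ'

end NodeOO

/-! ## §5 (v1.1). N06's KERNEL-BOUND CURRENCY ⇒ COORDINATE DECAY: input (ii) of the reader BY NAME from a (3.108)-type pointwise bound

N06 reads a letter `O` through sups of `‖(O(J ⊗ E))(x)‖` over the unit ball of `𝔸` (`Node00.kernelFamilyB ∕ kernelFamilyS`, the (3.42) ∕ (3.108)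
co-readings).  A pointwise kernel bound `‖(Φ(δ_x ⊗ E))(y)‖ ≤ B_G·‖E‖·e^{−ρ d(ℓ y, ℓ x)}` (Theorem 3.10's (3.108) «|G(U)(x,x′)| ≤ …e^{−δd(x,x′)}» at ONE
background, homogeneous in `E`) turns into the decay `hG` of the `toMatrix` entries that §3 ∕ §4 display, at the price of TWO BASIS NUMERALS `cb`
(`‖b.repr a k‖ ≤ cb‖a‖`) and `cl` (`‖b_l‖ ≤ cl`) — located numerals of the chosen basis (for `M_N(ℂ)`'s matrix units with the sup norm both are `1`). -/

section KernelBound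

variable {ν : ℕ} {Nf : Fin ν → ℕ} [∀ i, NeZero (Nf i)]
variable {X κ 𝔸 : Type} [Fintype X] [DecidableEq X] [Fintype κ] [DecidableEq κ] [NormedAddCommGroup 𝔸] [NormedSpace ℂ 𝔸]
variable (b : Basis κ ℂ 𝔸)

omit [Fintype X] [Fintype κ] [DecidableEq κ] in
/-- A UNIT-BALL kernel bound is a HOMOGENEOUS one (linearity of `Φ` and of `δ_x ⊗ ·`). [folklore]
[cite: Balaban1985BackgroundPropagators, (3.42) p.397 («for x ∈ Δ(y) … supp J ⊂ Δ(y′)»), Thm 3.10 (3.108) p.416] -/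
theorem kernelBound_of_unitBall (Φ : Module.End ℂ (X → 𝔸)) (ℓ : X → UT Nf) {BG ρ : ℝ}
    (h1 : ∀ x y (E : 𝔸), ‖E‖ ≤ 1 → ‖Φ (Pi.single x E) y‖ ≤ BG * Real.exp (-(ρ * tdist1 Nf (ℓ y) (ℓ x)))) (x y : X) (E : 𝔸) :
    ‖Φ (Pi.single x E) y‖ ≤ BG * ‖E‖ * Real.exp (-(ρ * tdist1 Nf (ℓ y) (ℓ x))) := by
  by_cases hE : E = 0
  · subst hE
    simp only [Pi.single_zero, map_zero, Pi.zero_apply, norm_zero, mul_zero, zero_mul, le_refl]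
  · have hn : 0 < ‖E‖ := norm_pos_iff.2 hE
    have hunit : ‖((‖E‖⁻¹ : ℝ) : ℂ) • E‖ ≤ 1 := by
      rw [norm_smul, Complex.norm_real, Real.norm_eq_abs, abs_of_pos (inv_pos.2 hn), inv_mul_cancel₀ hn.ne']
    have hdec : E = ((‖E‖ : ℝ) : ℂ) • (((‖E‖⁻¹ : ℝ) : ℂ) • E) := by
      rw [smul_smul, ← Complex.ofReal_mul, mul_inv_cancel₀ hn.ne', Complex.ofReal_one, one_smul]
    have key := h1 x y _ hunit
    calc ‖Φ (Pi.single x E) y‖ = ‖Φ (Pi.single x (((‖E‖ : ℝ) : ℂ) • (((‖E‖⁻¹ : ℝ) : ℂ) • E))) y‖ := by rw [← hdec]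
      _ = ‖E‖ * ‖Φ (Pi.single x (((‖E‖⁻¹ : ℝ) : ℂ) • E)) y‖ := by
          rw [Pi.single_smul, map_smul, Pi.smul_apply, norm_smul, Complex.norm_real, Real.norm_eq_abs, abs_of_pos hn]
      _ ≤ ‖E‖ * (BG * Real.exp (-(ρ * tdist1 Nf (ℓ y) (ℓ x)))) := mul_le_mul_of_nonneg_left key hn.le
      _ = BG * ‖E‖ * Real.exp (-(ρ * tdist1 Nf (ℓ y) (ℓ x))) := by ring

/-- The product-basis matrix entry is a coordinate of a kernel value: `‖toMatrix B′ B′ Φ (y,k) (x,l)‖ ≤ cb·‖Φ(δ_x ⊗ b_l)(y)‖` once `‖b.repr a k‖ ≤ cb‖a‖`.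
[folklore] [cite: Balaban1985BackgroundPropagators, (3.107)–(3.108) p.416, dictionary] -/
theorem norm_toMatrix_piProd_le (Φ : Module.End ℂ (X → 𝔸)) {cb : ℝ} (hcb : ∀ (a : 𝔸) (k : κ), ‖b.repr a k‖ ≤ cb * ‖a‖) (i j : X × κ) :
    ‖LinearMap.toMatrix ((Pi.basis fun _ : X => b).reindex (Equiv.sigmaEquivProd X κ))
      ((Pi.basis fun _ : X => b).reindex (Equiv.sigmaEquivProd X κ)) Φ i j‖ ≤ cb * ‖Φ (Pi.single j.1 (b j.2)) i.1‖ := by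
  rw [toMatrix_piProd_apply]
  exact hcb _ _

/-- ★ **KERNEL BOUND ⇒ COORDINATE DECAY**: a homogeneous pointwise bound `‖Φ(δ_x ⊗ E)(y)‖ ≤ B_G‖E‖e^{−ρ d(ℓ y, ℓ x)}` and the two basis numerals
`cb`, `cl` give `‖toMatrix B′ B′ Φ (y,k) (x,l)‖ ≤ (cb·cl·B_G)·e^{−ρ d(ℓ y, ℓ x)}` — the `hG` of §3 ∕ §4 at the location map `(x,k) ↦ ℓ x`.
[cite: Balaban1985BackgroundPropagators, Thm 3.10 (3.107)–(3.108) p.416, (3.42) p.397] -/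
theorem toMatrix_decay_of_kernelBound (Φ : Module.End ℂ (X → 𝔸)) {cb cl BG ρ : ℝ} (hcb : ∀ (a : 𝔸) (k : κ), ‖b.repr a k‖ ≤ cb * ‖a‖)
    (hcb0 : 0 ≤ cb) (hcl : ∀ l, ‖b l‖ ≤ cl) (hBG : 0 ≤ BG) (ℓ : X → UT Nf)
    (hO : ∀ x y (E : 𝔸), ‖Φ (Pi.single x E) y‖ ≤ BG * ‖E‖ * Real.exp (-(ρ * tdist1 Nf (ℓ y) (ℓ x)))) (i j : X × κ) :
    ‖LinearMap.toMatrix ((Pi.basis fun _ : X => b).reindex (Equiv.sigmaEquivProd X κ))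
      ((Pi.basis fun _ : X => b).reindex (Equiv.sigmaEquivProd X κ)) Φ i j‖ ≤
        cb * cl * BG * Real.exp (-(ρ * tdist1 Nf (ℓ i.1) (ℓ j.1))) := by
  refine (norm_toMatrix_piProd_le b Φ hcb i j).trans ?_
  have h := hO j.1 i.1 (b j.2)
  have hexp := Real.exp_nonneg (-(ρ * tdist1 Nf (ℓ i.1) (ℓ j.1)))
  calc cb * ‖Φ (Pi.single j.1 (b j.2)) i.1‖ ≤ cb * (BG * ‖b j.2‖ * Real.exp (-(ρ * tdist1 Nf (ℓ i.1) (ℓ j.1)))) :=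
        mul_le_mul_of_nonneg_left h hcb0
    _ ≤ cb * (BG * cl * Real.exp (-(ρ * tdist1 Nf (ℓ i.1) (ℓ j.1)))) := by
        refine mul_le_mul_of_nonneg_left (mul_le_mul_of_nonneg_right ?_ hexp) hcb0
        exact mul_le_mul_of_nonneg_left (hcl j.2) hBG
    _ = cb * cl * BG * Real.exp (-(ρ * tdist1 Nf (ℓ i.1) (ℓ j.1))) := by ring

variable {E : Type*} [NormedAddCommGroup E] [NormedSpace ℂ E]

/-- ★★ **THE INVERSE READER WITH INPUT (ii) IN N06's KERNEL-BOUND CURRENCY**: as §3 `rawEntryLetters_toMatrix_ringInverse_located`, with the centre's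
decay supplied as a pointwise kernel bound on the right inverse `Ψ₀` (`‖Ψ₀(δ_x ⊗ E)(y)‖ ≤ B_G‖E‖e^{−ρ d(ℓ y, ℓ x)}` — Theorem 3.10's (3.108) at ONE background,
its owner's) plus the basis numerals `cb, cl ≥ 0`; location map `(x,k) ↦ ℓ x`; conclusion constant `2·(cb·cl·B_G)`.
[cite: Balaban1985BackgroundPropagators, (3.27) p.395, (3.60)–(3.65) p.402, (3.86) p.407, Thm 3.10 (3.107)–(3.108) p.416; Balaban1988RG2Cluster, p.13, p.15] -/
theorem rawEntryLetters_toMatrix_ringInverse_located_of_kernelBound (Φ : E → Module.End ℂ (X → 𝔸)) {Ψ₀ : Module.End ℂ (X → 𝔸)}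
    (ℓ : X → UT Nf) {R ρ B BG cb cl : ℝ} {m : ℕ}
    (hA : RawEntryLetters (fun u => LinearMap.toMatrix ((Pi.basis fun _ : X => b).reindex (Equiv.sigmaEquivProd X κ))
      ((Pi.basis fun _ : X => b).reindex (Equiv.sigmaEquivProd X κ)) (Φ u)) (fun p : X × κ => ℓ p.1) R ρ B)
    (h0 : Φ 0 * Ψ₀ = 1)
    (hcb : ∀ (a : 𝔸) (k : κ), ‖b.repr a k‖ ≤ cb * ‖a‖) (hcb0 : 0 ≤ cb) (hcl : ∀ l, ‖b l‖ ≤ cl) (hcl0 : 0 ≤ cl) (hBG : 0 ≤ BG)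
    (hO : ∀ x y (a : 𝔸), ‖Ψ₀ (Pi.single x a) y‖ ≤ BG * ‖a‖ * Real.exp (-(ρ * tdist1 Nf (ℓ y) (ℓ x))))
    (hfib : ∀ y : UT Nf, (univ.filter fun p : X × κ => ℓ p.1 = y).card ≤ m) (hR : 0 < R)
    {ρ' : ℝ} (hρ'0 : 0 ≤ ρ') (hρ' : ρ' < ρ) :
    RawEntryLetters (fun u => LinearMap.toMatrix ((Pi.basis fun _ : X => b).reindex (Equiv.sigmaEquivProd X κ))
        ((Pi.basis fun _ : X => b).reindex (Equiv.sigmaEquivProd X κ)) (Ring.inverse (Φ u))) (fun p : X × κ => ℓ p.1)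
      (R / (4 * (B * (cb * cl * BG) * (m * B6.c0 1 ((ρ - ρ') / 3) ^ ν) * (m * B6.c0 1 ((ρ - ρ') / 3) ^ ν)) + 1)) ρ'
      (2 * (cb * cl * BG)) :=
  rawEntryLetters_toMatrix_ringInverse_located b Φ hA h0 (toMatrix_decay_of_kernelBound b Ψ₀ hcb hcb0 hcl hBG ℓ hO)
    (mul_nonneg (mul_nonneg hcb0 hcl0) hBG) hfib hR hρ'0 hρ'

end KernelBound

end Literature.MathematicalPhysics.QuantumFieldTheory.Balaban1983to89.B13InverseOperatorCoordinates

end
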